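import Literature.MathematicalPhysics.QuantumFieldTheory.TwistedPartitionFunctionRPBound
import Literature.MathematicalPhysics.QuantumFieldTheory.WilsonSiteRPForm
import Literature.MathematicalPhysics.QuantumFieldTheory.ConstructiveQFTWave0WilsonLoopRPProofs
import HarnessLib

/-!
# Tomboulis–Yaffe: the Polyakov-loop correlator at separation `L/2` is bounded by the twist

E. T. Tomboulis and L. G. Yaffe, Comm. Math. Phys. **100** (1985) 313–341, Appendix I §C, eq.
(A1.8): on the periodic lattice, the two-point function of Polyakov loops ("traces of the twist")
at the maximal separation `L_s/2` is bounded by the electric-flux free energy,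
`G_{L_s/2} ≤ 2 exp(-F^{elec}/2T)` with `exp(-F^{elec}/T) = ½ (1 - exp(-F^{mag}/T))` (eq. (2.9)) and
`exp(-F^{mag}/T) = ⟨τ[S₀₁]⟩ = Z⁻/Z` the ratio of 't Hooft's twisted to the untwisted partition
function (eq. (2.8)). The printed proof: insert `1 = ½(1 - τ[S]) + ½(1 + τ[S])` into `G_{L/2}`; in
the `τ` part "make a change of variables which flips the signs of the set of timelike links `L₀`",
which moves the twisted stack across one of the two Polyakov loops and flips the sign of its trace;
then "apply reflection positivity using a reflection which leaves invariant [the] planes containing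
`Ω[0]` and `Ω[x]`", "considering both traces of the twist to be on opposite sides of the lattice
from `τ[S₀₁]`" (Cauchy–Schwarz, the loops contributing `|½ tr Ω|² ≤ 1`), and evaluate
`⟨½(1 - τ[S]) θ(½(1 - τ[S]))⟩ = ½(1 - Z⁻/Z)` (two opposite twists on homologous stacks cancel).

This file proves the torus form of (A1.8) for Wilson's lattice gauge theory on `(ℤ/Lℤ)^d`, `L`
even, with a compact gauge group `G`, a continuous `N`-dimensional representation `ρ`, ANY real `β`,
and a central element `z` acting in `ρ` as a scalar `ω` of modulus one
(`polyakovCorrelator_half_normSq_le_twist`):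

  `|1 - ω|² · |⟨tr ρ(Πⱼ(0)) · conj tr ρ(Πⱼ((L/2) e₀))⟩|² ≤ 8 N⁴ (1 - Z(z; (0,j)) / Z(1; (0,j)))`,

where `Πⱼ(x) = lineHolonomy U j L x` is the Polyakov loop winding once around the torus in the
spatial direction `j` through `x`, and `Z(z; q) = twistedPartitionFunction ρ β L z q` is the tree's
't Hooft partition function with a `z`-twisted stack in the plane `q = (0, j)`. For `ω = -1`
(`SU(2)`, or `z = -1 ∈ SU(2n)`) this is exactly (A1.8) with normalised traces:
`G_{L/2}² ≤ 2 (1 - Z⁻/Z) = 4 · ½(1 - Z⁻/Z)` (`polyakovCorrelator_half_normSq_le_twist_of_neg`). The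
ingredients are the tree's: the stack-moving substitution `U ↦ cU`
(`stackInsertion_mul_coboundary_fst`, here with an observable: `integral_mul_exp_stack_succ`), the
reflection of a twisted action (`insertedWilsonAction_stack_negReflect`), the cancellation of
opposite adjacent stacks (`insertedPartitionFunction_stack_mul_inv_stack`), and the Cauchy–Schwarz
inequality of the site-reflection form (`WilsonSiteRP.normSq_siteRPForm_le`).

The other links of the Tomboulis–Yaffe chain are in `TomboulisYaffeLoopBounds.lean`; the assembled
inequalities ((A1.9)/(2.10) and the Wilson-loop bound) in `TomboulisYaffeInequality.lean`. All
statements here are proved; there are no definitions.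

## References

* E. T. Tomboulis, L. G. Yaffe, Comm. Math. Phys. 100 (1985) 313–341, §II (2.8)–(2.10), App. I §C
  (A1.8). [TomboulisYaffe1985]
* T. Kanazawa, Ann. Phys. 324 (2009) 1634 (arXiv:0808.3442), §2 Lemma 1 (11), Lemma 2 (15)–(18)
  (the same steps for `SU(N)`). [Kanazawa2008]
-/

open MeasureTheory Finset Complex
open scoped ComplexOrder ComplexConjugate

namespace Literature.MathematicalPhysics.QuantumFieldTheory

noncomputable section

namespace TomboulisYaffe

open WilsonRP WilsonSiteRP Literature.RepresentationTheory.CompactGroups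

variable {d L N : ℕ} [NeZero d] [NeZero L] {G : Type*} [Group G] [TopologicalSpace G]
  [IsTopologicalGroup G] [CompactSpace G] [MeasurableSpace G] [BorelSpace G]
  (ρ : G →* Matrix (Fin N) (Fin N) ℂ)

/-! ## Torus expectations as integrals against the product Haar measure -/

section Expectation

omit [NeZero d] in
/-- `⟨f⟩_{Λ,β} = Z₁⁻¹ ∫ exp(-β S(U)) f(U) ∏ dU_e` with `Z₁ = ∫ exp(-β S) ∏ dU_e` the untwisted
partition function (a real number, `insertedPartitionFunction ρ β L 1`). [folklore] -/
private theorem wilsonExpectation_eq_smul_integral (hρ : Continuous ρ) (β : ℝ)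
    (f : GaugeConfig d L G → ℂ) :
    wilsonExpectation ρ β f =
      (insertedPartitionFunction ρ β L (fun _ : Plaquette d L => (1 : G)))⁻¹ •
        ∫ U : GaugeConfig d L G, (Real.exp (-β * wilsonAction ρ U) : ℂ) * f U
          ∂(Measure.pi fun _ : Edge d L => haarProbability G) := by
  have hdens : Measurable fun U : GaugeConfig d L G =>
      ENNReal.ofReal (Real.exp (-β * wilsonAction ρ U)) :=
    ENNReal.measurable_ofReal.comp ((WilsonRP.measurable_wilsonAction ρ hρ).const_mul (-β)).exp
  unfold wilsonExpectation wilsonMeasure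
  rw [integral_smul_measure, insertedPartitionFunction_one ρ hρ β, ENNReal.toReal_inv]
  unfold wilsonWeight
  rw [integral_withDensity_eq_integral_toReal_smul hdens (ae_of_all _ fun _ => ENNReal.ofReal_lt_top)]
  simp_rw [ENNReal.toReal_ofReal (Real.exp_nonneg _), Complex.real_smul]

omit [NeZero d] in
/-- The expectation of `f · exp(β(S - S_t))` is `Z₁⁻¹ ∫ f exp(-β S_t)`: inserting the twist
observable replaces the Boltzmann weight by the twisted one. [folklore] -/
private theorem wilsonExpectation_mul_twistObs (hρ : Continuous ρ) (β : ℝ) (t : Plaquette d L → G)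
    (f : GaugeConfig d L G → ℂ) :
    wilsonExpectation ρ β (fun U : GaugeConfig d L G =>
        f U * (Real.exp (β * (wilsonAction ρ U - insertedWilsonAction ρ t U)) : ℂ)) =
      (insertedPartitionFunction ρ β L (fun _ : Plaquette d L => (1 : G)))⁻¹ •
        ∫ U : GaugeConfig d L G, f U * (Real.exp (-(β * insertedWilsonAction ρ t U)) : ℂ)
          ∂(Measure.pi fun _ : Edge d L => haarProbability G) := by
  rw [wilsonExpectation_eq_smul_integral ρ hρ β]
  congr 1
  refine integral_congr_ae (ae_of_all _ fun U => ?_)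
  have hexp : -β * wilsonAction ρ U + β * (wilsonAction ρ U - insertedWilsonAction ρ t U) =
      -(β * insertedWilsonAction ρ t U) := by ring
  show ((Real.exp (-β * wilsonAction ρ U) : ℝ) : ℂ) *
      (f U * (Real.exp (β * (wilsonAction ρ U - insertedWilsonAction ρ t U)) : ℂ)) =
    f U * (Real.exp (-(β * insertedWilsonAction ρ t U)) : ℂ)
  rw [mul_left_comm, ← Complex.ofReal_mul, ← Real.exp_add, hexp]

end Expectation

/-! ## Moving the twisted stack across a Polyakov loop -/

section Move

omit [NeZero d] in
/-- **Moving the stack by the change of variables `U ↦ cU`, in the presence of an observable**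
(Tomboulis–Yaffe 1985 App. I §C: "we may make a change of variables which flips the signs of the
set of timelike links `L₀ = {l₀(n) | n₀ = n₁ = 0}`. This yields … `S'₀₁ = {P₀₁(n) | n₀ = 0, n₁ = -1}`";
Kanazawa 2009 Lemma 1: "redefinition of variables `U → z^{k'} U` to bring `𝒱'` to `𝒱`"). Torus form:
for a central `z`, a plane `q = (μ, ν)` and any observable `f`,
`∫ f(U) e^{-β S_{z,(a,b)}(U)} = ∫ f(cU) e^{-β S_{z,(a+1,b)}(U)}` where `c = z⁻¹` on the `ν`-links
`{y_μ = a + 1, y_ν = b}` and `1` elsewhere (left invariance of the product Haar measure and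
`stackInsertion_mul_coboundary_fst`). [cite: TomboulisYaffe1985, App. I §C] -/
theorem integral_mul_exp_stack_succ (β : ℝ) {z : G} (hz : z ∈ Subgroup.center G)
    (q : {p : Fin d × Fin d // p.1 < p.2}) (a b : ZMod L) (f : GaugeConfig d L G → ℂ) :
    ∫ U : GaugeConfig d L G, f U *
        (Real.exp (-(β * insertedWilsonAction ρ (stackInsertion z q a b) U)) : ℂ)
        ∂(Measure.pi fun _ : Edge d L => haarProbability G) =
      ∫ U : GaugeConfig d L G,
        f ((fun e : Edge d L => if e.2 = q.1.2 ∧ e.1 q.1.1 = a + 1 ∧ e.1 q.1.2 = b then z⁻¹ else 1) * U) *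
          (Real.exp (-(β * insertedWilsonAction ρ (stackInsertion z q (a + 1) b) U)) : ℂ)
        ∂(Measure.pi fun _ : Edge d L => haarProbability G) := by
  set c : Edge d L → G := fun e => if e.2 = q.1.2 ∧ e.1 q.1.1 = a + 1 ∧ e.1 q.1.2 = b then z⁻¹ else 1
    with hc_def
  have hc : ∀ e, c e ∈ Subgroup.center G := fun e => by
    rw [hc_def]; dsimp only; split_ifs; exacts [Subgroup.inv_mem _ hz, Subgroup.one_mem _]
  have hS : ∀ U : GaugeConfig d L G, insertedWilsonAction ρ (stackInsertion z q (a + 1) b) U =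
      insertedWilsonAction ρ (stackInsertion z q a b) (c * U) := fun U => by
    rw [insertedWilsonAction_central_mul ρ hc]
    congr 1
    funext p
    exact (stackInsertion_mul_coboundary_fst z q a b p).symm
  simp_rw [hS]
  exact (integral_mul_left_eq_self (μ := Measure.pi fun _ : Edge d L => haarProbability G)
    (fun U : GaugeConfig d L G => f U *
      (Real.exp (-(β * insertedWilsonAction ρ (stackInsertion z q a b) U)) : ℂ)) c).symm

omit [NeZero L] [TopologicalSpace G] [IsTopologicalGroup G] [CompactSpace G] [MeasurableSpace G]
  [BorelSpace G] in
/-- A straight line in direction `j` based outside the time slice carrying the substitution is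
unchanged by `U ↦ cU`. [folklore] -/
private theorem lineHolonomy_stackMove_of_ne {j : Fin d} (hj : j ≠ 0) (z : G) (a b : ZMod L)
    (U : GaugeConfig d L G) (n : ℕ) (y : Site d L) (hy : y 0 ≠ a + 1) :
    lineHolonomy ((fun e : Edge d L => if e.2 = j ∧ e.1 0 = a + 1 ∧ e.1 j = b then z⁻¹ else 1) * U)
        j n y = lineHolonomy U j n y := by
  refine WilsonLoopRP.lineHolonomy_congr j n y fun s _ => ?_
  rw [Pi.mul_apply]
  dsimp only
  rw [if_neg, one_mul]
  rintro ⟨-, h0, -⟩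
  exact hy (by simpa [Pi.single_eq_of_ne hj.symm] using h0)

omit [NeZero L] [TopologicalSpace G] [IsTopologicalGroup G] [CompactSpace G] [MeasurableSpace G]
  [BorelSpace G] in
/-- **A Polyakov loop crossing the moved stack picks up the central element**: the closed line of
`L` links in direction `j` through the point `y` of the substituted time slice with `y_j = b` meets
exactly one substituted link, so its holonomy is multiplied by `z⁻¹` (TY: the change of variables
"changes the sign" of `tr Ω[0]`; Kanazawa (19): `W_R(C) → z^{±N(R)k} W_R(C)`). [folklore] -/
private theorem lineHolonomy_stackMove_of_eq [Fact (1 < L)] {j : Fin d} {z : G} (a b : ZMod L)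
    (U : GaugeConfig d L G) (y : Site d L) (hy0 : y 0 = a + 1) (hyj : y j = b) :
    lineHolonomy ((fun e : Edge d L => if e.2 = j ∧ e.1 0 = a + 1 ∧ e.1 j = b then z⁻¹ else 1) * U)
        j L y = z⁻¹ * lineHolonomy U j L y := by
  set c : Edge d L → G := fun e => if e.2 = j ∧ e.1 0 = a + 1 ∧ e.1 j = b then z⁻¹ else 1 with hc
  have h1L : 1 < L := Fact.out
  have hL1 : L = (L - 1) + 1 := by omega
  have step : ∀ V : GaugeConfig d L G, lineHolonomy V j L y = lineHolonomy V j ((L - 1) + 1) y :=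
    fun V => congrArg (fun n => lineHolonomy V j n y) hL1
  rw [step, step, lineHolonomy, lineHolonomy, Pi.mul_apply]
  have hhead : c (y, j) = z⁻¹ := by rw [hc]; dsimp only; rw [if_pos ⟨rfl, hy0, hyj⟩]
  have htail : lineHolonomy (c * U) j (L - 1) (y.shift j) = lineHolonomy U j (L - 1) (y.shift j) := by
    refine WilsonLoopRP.lineHolonomy_congr j (L - 1) _ fun s hs => ?_
    rw [Pi.mul_apply, hc]
    dsimp only
    rw [if_neg, one_mul]
    rintro ⟨-, -, hb⟩
    have hval : (y.shift j + Pi.single j ((s : ℕ) : ZMod L) : Site d L) j = b + ((s + 1 : ℕ) : ZMod L) := by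
      simp only [Site.shift, Pi.add_apply, Pi.single_eq_same, hyj]
      push_cast; ring
    rw [hval, add_eq_left] at hb
    have := (ZMod.natCast_eq_zero_iff _ _).1 hb
    exact absurd (Nat.le_of_dvd (by omega) this) (by omega)
  rw [hhead, htail, mul_assoc]

end Move

/-! ## The twist observables -/

section TwistObs

omit [NeZero d] [TopologicalSpace G] [IsTopologicalGroup G] [CompactSpace G] [MeasurableSpace G]
  [BorelSpace G] in
/-- Two stacks of the same plane at different heights are disjoint, so their inserted actions add
up: `S_t + S_{t'} = S_{t t'} + S_1` (a copy of the private lemma of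
`TwistedPartitionFunctionRPBound`). [folklore] -/
private theorem insertedWilsonAction_stack_add_stack (z z' : G)
    (q : {p : Fin d × Fin d // p.1 < p.2}) {a a' : ZMod L} (haa' : a ≠ a') (b : ZMod L)
    (U : GaugeConfig d L G) :
    insertedWilsonAction ρ (stackInsertion z q a b) U +
        insertedWilsonAction ρ (stackInsertion z' q a' b) U =
      insertedWilsonAction ρ (fun p => stackInsertion z q a b p * stackInsertion z' q a' b p) U +
        wilsonAction ρ U := by
  rw [← insertedWilsonAction_one ρ U]
  unfold insertedWilsonAction
  rw [← Finset.sum_add_distrib, ← Finset.sum_add_distrib]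
  refine Finset.sum_congr rfl fun p _ => ?_
  unfold stackInsertion
  by_cases h : p.2 = q ∧ p.1 q.1.1 = a ∧ p.1 q.1.2 = b
  · obtain ⟨hq, ha, hb⟩ := h
    simp [hq, ha, hb, haa']
  · simp only [h, ↓reduceIte, one_mul]
    ring

omit [NeZero d] [MeasurableSpace G] [BorelSpace G] in
/-- Crude uniform bound on a twist observable: `|exp(β(S - S_t))| ≤ exp(2|β| · 2N · #plaquettes)`.
[folklore] -/
private theorem norm_twistObs_le (hρ : Continuous ρ) (β : ℝ) (t : Plaquette d L → G)
    (U : GaugeConfig d L G) :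
    ‖((Real.exp (β * (wilsonAction ρ U - insertedWilsonAction ρ t U)) : ℝ) : ℂ)‖ ≤
      Real.exp (2 * (|β| * (2 * N * Fintype.card (Plaquette d L)))) := by
  rw [Complex.norm_real, Real.norm_eq_abs, abs_of_pos (Real.exp_pos _)]
  refine Real.exp_le_exp.2 ?_
  have key : ∀ s : Plaquette d L → G,
      |β * insertedWilsonAction ρ s U| ≤ |β| * (2 * N * Fintype.card (Plaquette d L)) := fun s => by
    rw [abs_mul]
    exact mul_le_mul_of_nonneg_left (abs_insertedWilsonAction_le ρ hρ s U) (abs_nonneg _)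
  have h1 := (le_abs_self _).trans (key fun _ => 1)
  have h2 := (neg_le_abs _).trans (key t)
  rw [insertedWilsonAction_one] at h1
  rw [mul_sub]
  linarith

variable [Fact (1 < L)]

/-- **The twist observable of a stack in the first time slab is an admissible half-observable**:
`U ↦ exp(β(S(U) - S_{w,(0,b)}(U)))` depends only on the links of the plaquettes of the stack
`{x₀ = 0, x_j = b}`, which lie in the closed positive half, and is bounded (the step "F is an
observable of the links of the stack plaquettes" of `twistedPartitionFunction_le_untwisted`).
[folklore] -/
private theorem isHalfObs_twistObs (hL : Even L) (hρ : Continuous ρ) (β : ℝ) (w : G) {j : Fin d}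
    (hj : (0 : Fin d) < j) (b : ZMod L) (κ : ℂ) :
    IsHalfObs (fun U : GaugeConfig d L G => κ - (Real.exp (β * (wilsonAction ρ U -
      insertedWilsonAction ρ (stackInsertion w ⟨(0, j), hj⟩ 0 b) U)) : ℂ)) := by
  set t := stackInsertion w ⟨((0 : Fin d), j), hj⟩ (0 : ZMod L) b with ht
  have hFr : Measurable fun U : GaugeConfig d L G =>
      Real.exp (β * (wilsonAction ρ U - insertedWilsonAction ρ t U)) :=
    Real.measurable_exp.comp (((WilsonRP.measurable_wilsonAction ρ hρ).sub
      (measurable_insertedWilsonAction ρ hρ t)).const_mul β)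
  have hE : ∀ e : Edge d L, IsSitePosEdge e ∨ IsSharedEdge e →
      e ∈ ((sitePosEdges ∪ sharedEdges : Finset (Edge d L)) : Set (Edge d L)) := fun e he => by
    rw [Finset.coe_union, Set.mem_union, Finset.mem_coe, Finset.mem_coe, mem_sitePosEdges,
      mem_sharedEdges]
    exact he
  refine ⟨Complex.measurable_ofReal.comp hFr |>.const_sub κ,
    ⟨‖κ‖ + Real.exp (2 * (|β| * (2 * N * Fintype.card (Plaquette d L)))),
    fun U => (norm_sub_le _ _).trans (add_le_add le_rfl (norm_twistObs_le ρ hρ β t U))⟩,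
    fun U V hUV => ?_⟩
  · suffices h : wilsonAction ρ U - insertedWilsonAction ρ t U =
        wilsonAction ρ V - insertedWilsonAction ρ t V by
      simp only [h]
    rw [← insertedWilsonAction_one ρ U, ← insertedWilsonAction_one ρ V]
    unfold insertedWilsonAction
    rw [← Finset.sum_sub_distrib, ← Finset.sum_sub_distrib]
    refine Finset.sum_congr rfl fun p _ => ?_
    by_cases hp : p.2 = ⟨((0 : Fin d), j), hj⟩ ∧ p.1 0 = 0 ∧ p.1 j = b
    · have htp : t p = w := if_pos hp
      have hpos : IsSitePosPlaq p := by
        have h1 : p.2.1.1 = 0 := by rw [hp.1]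
        unfold IsSitePosPlaq
        rw [if_pos h1, hp.2.1, ZMod.val_zero]
        have : 1 < L := Fact.out
        omega
      obtain ⟨e1, e2, e3, e4⟩ := edges_of_isSitePosPlaq hL hpos
      have u1 := hUV _ (hE _ e1)
      have u2 := hUV _ (hE _ e2)
      have u3 := hUV _ (hE _ e3)
      have u4 := hUV _ (hE _ e4)
      simp only [htp, plaquetteHolonomy, u1, u2, u3, u4]
    · have htp : t p = 1 := if_neg hp
      simp [htp]

omit [NeZero d] [Fact (1 < L)] in
/-- **Expectation of a twist observable** = the twist ratio: `⟨exp(β(S - S_{w,(a,b)}))⟩_{Λ,β} =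
Z(w; q)/Z(1; q)` for central `w` (any stack position; Kanazawa (8): `⟨𝒪^{[k]}[𝒱]⟩ = Z^{[k]}/Z`;
Tomboulis–Yaffe (2.8)). [cite: TomboulisYaffe1985, §II eq. (2.8)] -/
theorem wilsonExpectation_twistObs (hρ : Continuous ρ) (β : ℝ) {w : G} (hw : w ∈ Subgroup.center G)
    (q : {p : Fin d × Fin d // p.1 < p.2}) (a b : ZMod L) :
    wilsonExpectation ρ β (fun U : GaugeConfig d L G => (Real.exp (β * (wilsonAction ρ U -
      insertedWilsonAction ρ (stackInsertion w q a b) U)) : ℂ)) =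
      ((twistedPartitionFunction ρ β L w q / twistedPartitionFunction ρ β L 1 q : ℝ) : ℂ) := by
  have h := wilsonExpectation_mul_twistObs ρ hρ β (stackInsertion w q a b) (fun _ => (1 : ℂ))
  simp only [one_mul] at h
  rw [h, integral_complex_ofReal, Complex.real_smul, ← Complex.ofReal_mul]
  congr 1
  change _ * insertedPartitionFunction ρ β L (stackInsertion w q a b) = _
  rw [← twistedPartitionFunctionAt_eq_inserted, twistedPartitionFunctionAt_eq ρ β hw,
    twistedPartitionFunction_eq_at ρ β (1 : G) q, twistedPartitionFunctionAt_eq_inserted, stackInsertion_one,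
    inv_mul_eq_div]

omit [NeZero d] in
/-- **Two opposite twists on adjacent homologous stacks cancel in expectation**:
`⟨exp(β(S - S_{w⁻¹,(a,b)})) · exp(β(S - S_{w,(a+1,b)}))⟩ = 1` (Kanazawa Lemma 1 (11) with `k' = -k`;
TY App. I §C "this change of variables transforms the second expectation into the first").
[cite: Kanazawa2008, §2 Lemma 1 eq. (11)] -/
theorem wilsonExpectation_twistObs_inv_mul_twistObs (hρ : Continuous ρ) (β : ℝ) {w : G}
    (hw : w ∈ Subgroup.center G) (q : {p : Fin d × Fin d // p.1 < p.2}) (a b : ZMod L) :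
    wilsonExpectation ρ β (fun U : GaugeConfig d L G =>
      (Real.exp (β * (wilsonAction ρ U - insertedWilsonAction ρ (stackInsertion w⁻¹ q a b) U)) : ℂ) *
      (Real.exp (β * (wilsonAction ρ U - insertedWilsonAction ρ (stackInsertion w q (a + 1) b) U)) : ℂ)) =
      1 := by
  have ha : a + 1 ≠ a := by
    rw [ne_eq, add_eq_left]
    exact one_ne_zero
  have hsum : ∀ U : GaugeConfig d L G, insertedWilsonAction ρ (stackInsertion w q (a + 1) b) U +
      insertedWilsonAction ρ (stackInsertion w⁻¹ q a b) U =
      insertedWilsonAction ρ (fun p => stackInsertion w q (a + 1) b p * stackInsertion w⁻¹ q a b p) U +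
        wilsonAction ρ U := fun U =>
    insertedWilsonAction_stack_add_stack ρ w w⁻¹ q ha b U
  have hpt : ∀ U : GaugeConfig d L G,
      ((Real.exp (β * (wilsonAction ρ U - insertedWilsonAction ρ (stackInsertion w⁻¹ q a b) U)) : ℝ) : ℂ) *
        (Real.exp (β * (wilsonAction ρ U - insertedWilsonAction ρ (stackInsertion w q (a + 1) b) U)) : ℂ) =
      (1 : ℂ) * (Real.exp (β * (wilsonAction ρ U - insertedWilsonAction ρ
        (fun p => stackInsertion w q (a + 1) b p * stackInsertion w⁻¹ q a b p) U)) : ℂ) := fun U => by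
    rw [one_mul, ← Complex.ofReal_mul, ← Real.exp_add]
    congr 2
    linear_combination (-β) * hsum U
  simp_rw [hpt]
  rw [wilsonExpectation_mul_twistObs ρ hρ β]
  simp only [one_mul]
  rw [integral_complex_ofReal, Complex.real_smul, ← Complex.ofReal_mul]
  change (((insertedPartitionFunction ρ β L fun _ => 1)⁻¹ *
    insertedPartitionFunction ρ β L
      (fun p => stackInsertion w q (a + 1) b p * stackInsertion w⁻¹ q a b p) : ℝ) : ℂ) = 1
  rw [insertedPartitionFunction_stack_mul_inv_stack ρ β hw q a b,
    inv_mul_cancel₀ (insertedPartitionFunction_pos ρ hρ β _).ne', Complex.ofReal_one]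

omit [MeasurableSpace G] [BorelSpace G] in
/-- **Reflection of a twist observable**: `exp(β(S - S_{w,(a,b)}))(Θ'U) = exp(β(S - S_{w⁻¹,(-(a+1),b)}))(U)`
(Kanazawa Lemma 2 (15): `θ[𝒪^{[k]}[𝒱]] = 𝒪^{[-k]}[𝒱^θ]`; the tree's
`insertedWilsonAction_stack_negReflect` and `WilsonSiteRP.wilsonAction_negReflect`).
[cite: Kanazawa2008, §2 Lemma 2 eq. (15)] -/
theorem twistObs_negReflect (hL : Even L) (hρ : Continuous ρ) (β : ℝ) {w : G}
    (hw : w ∈ Subgroup.center G) {j : Fin d} (hj : (0 : Fin d) < j) (a b : ZMod L)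
    (U : GaugeConfig d L G) :
    Real.exp (β * (wilsonAction ρ U.negReflect -
        insertedWilsonAction ρ (stackInsertion w ⟨(0, j), hj⟩ a b) U.negReflect)) =
      Real.exp (β * (wilsonAction ρ U -
        insertedWilsonAction ρ (stackInsertion w⁻¹ ⟨(0, j), hj⟩ (-(a + 1)) b) U)) := by
  rw [insertedWilsonAction_stack_negReflect ρ hρ hw j hj a b U, wilsonAction_negReflect ρ hL hρ U]

end TwistObs

/-! ## The bound at separation `L/2` (TY (A1.8)) -/

section HalfCorrelator

omit [NeZero d] [NeZero L] [MeasurableSpace G] [BorelSpace G] in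
/-- `‖tr ρ(g)‖ ≤ N` for a continuous representation of a compact group. [folklore] -/
private theorem norm_trace_le_dim (hρ : Continuous ρ) (g : G) : ‖(ρ g).trace‖ ≤ N := by
  rw [← CompactGroup.trace_unitarize ρ hρ, Matrix.trace]
  refine (norm_sum_le _ _).trans ?_
  calc ∑ k, ‖Matrix.diag (CompactGroup.unitarize ρ hρ g) k‖ ≤ ∑ _k : Fin N, (1 : ℝ) :=
        Finset.sum_le_sum fun k _ => CompactGroup.norm_unitarize_apply_le_one ρ hρ g k k
    _ = N := by simp

omit [NeZero d] [NeZero L] [TopologicalSpace G] [IsTopologicalGroup G] [CompactSpace G]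
  [MeasurableSpace G] [BorelSpace G] in
/-- A central element acting as the scalar `ω` multiplies traces by `ω`. [folklore] -/
private theorem trace_central_mul {z : G} {ω : ℂ} (hω : ρ z = ω • (1 : Matrix (Fin N) (Fin N) ℂ))
    (g : G) : (ρ (z * g)).trace = ω * (ρ g).trace := by
  rw [map_mul, hω, Matrix.smul_mul, Matrix.one_mul, Matrix.trace_smul, smul_eq_mul]

omit [NeZero d] [NeZero L] [TopologicalSpace G] [IsTopologicalGroup G] [CompactSpace G]
  [MeasurableSpace G] [BorelSpace G] in
/-- If `ρ(z) = ω · 1` with `ω ≠ 0` then `ρ(z⁻¹) = ω⁻¹ · 1`. [folklore] -/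
private theorem map_inv_eq_smul {z : G} {ω : ℂ} (hω0 : ω ≠ 0)
    (hω : ρ z = ω • (1 : Matrix (Fin N) (Fin N) ℂ)) :
    ρ z⁻¹ = ω⁻¹ • (1 : Matrix (Fin N) (Fin N) ℂ) := by
  have h1 : ρ z⁻¹ * ρ z = 1 := by rw [← map_mul, inv_mul_cancel, map_one]
  calc ρ z⁻¹ = ρ z⁻¹ * ρ z * (ω⁻¹ • (1 : Matrix (Fin N) (Fin N) ℂ)) := by
        rw [Matrix.mul_assoc, hω, Matrix.smul_mul, Matrix.one_mul, smul_smul, mul_inv_cancel₀ hω0,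
          one_smul, Matrix.mul_one]
    _ = ω⁻¹ • (1 : Matrix (Fin N) (Fin N) ℂ) := by rw [h1, Matrix.one_mul]

/-- **Tomboulis–Yaffe (A1.8): the Polyakov-loop correlator at separation `L/2` is bounded by the
twist.** Torus `(ℤ/Lℤ)^d` with `L` even, compact `G`, continuous `N`-dimensional `ρ`, any real `β`,
a spatial direction `j` (`0 < j`), and a central `z ∈ G` with `ρ(z) = ω · 1`, `|ω| = 1`. Let
`Πⱼ(x) = lineHolonomy U j L x` be the Polyakov loop in direction `j` through `x`,
`E = ⟨tr ρ(Πⱼ(0)) · conj tr ρ(Πⱼ((L/2) e₀))⟩_{Λ,β}`, and `r = Z(z; (0,j)) / Z(1; (0,j))` the ratio of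
't Hooft's twisted to the untwisted partition function (`twistedPartitionFunction`). Then
`|1 - ω|² |E|² ≤ 8 N⁴ (1 - r)`. For `SU(2)` (`ω = -1`) and normalised traces this is the printed
`G_{L_s/2} ≤ 2 exp(-F^{elec}/2T)` with `exp(-F^{elec}/T) = ½(1 - r)` (eqs. (2.8)–(2.9), (A1.8)). Proof
as printed: `(1 - ω) E = ⟨P P̄' (1 - 𝒪₀)⟩ - ω ⟨P P̄' (1 - 𝒪₋₁)⟩` (moving the stack across the loop at
time `0` multiplies it by `ω`), each term bounded by Cauchy–Schwarz for the reflection in the planes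
`t = 0, L/2` containing both loops, and `⟨(1 - 𝒪)θ(1 - 𝒪)⟩ = 2(1 - r)` by the cancellation of
opposite adjacent stacks. [cite: TomboulisYaffe1985, App. I §C eq. (A1.8)] -/
theorem polyakovCorrelator_half_normSq_le_twist (hL : Even L) (hρ : Continuous ρ) (β : ℝ)
    {j : Fin d} (hj : (0 : Fin d) < j) {z : G} (hz : z ∈ Subgroup.center G) {ω : ℂ}
    (hω : ρ z = ω • (1 : Matrix (Fin N) (Fin N) ℂ)) (hω1 : ‖ω‖ = 1) :
    ‖1 - ω‖ ^ 2 * ‖wilsonExpectation ρ β fun U : GaugeConfig d L G =>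
        (ρ (lineHolonomy U j L 0)).trace *
          conj ((ρ (lineHolonomy U j L ((0 : Site d L) + Pi.single 0 ((L / 2 : ℕ) : ZMod L)))).trace)‖ ^ 2 ≤
      8 * (N : ℝ) ^ 4 * (1 - twistedPartitionFunction ρ β L z ⟨(0, j), hj⟩ /
        twistedPartitionFunction ρ β L 1 ⟨(0, j), hj⟩) := by
  have h1L : 1 < L := by obtain ⟨r, hr⟩ := hL; have := NeZero.ne L; omega
  haveI : Fact (1 < L) := ⟨h1L⟩
  haveI := isProbabilityMeasure_wilsonMeasure (d := d) (L := L) ρ hρ β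
  have hj0 : j ≠ 0 := fun h => (lt_irrefl (0 : Fin d)) (h ▸ hj)
  set Z1 : ℝ := twistedPartitionFunction ρ β L 1 ⟨((0 : Fin d), j), hj⟩ with hZ1
  set Zz : ℝ := twistedPartitionFunction ρ β L z ⟨((0 : Fin d), j), hj⟩ with hZz
  set r : ℝ := Zz / Z1 with hr_def
  have hZ1pos : 0 < Z1 := twistedPartitionFunction_pos ρ hρ β 1 _
  have hr1 : r ≤ 1 :=
    (div_le_one hZ1pos).2 (twistedPartitionFunction_le_untwisted_plane ρ β hL hρ hz _)
  have hω0 : ω ≠ 0 := fun h => by rw [h, norm_zero] at hω1; exact zero_ne_one hω1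
  have hωinv := map_inv_eq_smul ρ hω0 hω
  obtain ⟨rr, hrr⟩ := hL
  set m : ℕ := L / 2 with hm_def
  have hmL : m + m = L := by omega
  have hmlt : m < L := by have := NeZero.ne L; omega
  have hm0 : ((m : ℕ) : ZMod L) ≠ 0 := fun h => by
    have := (ZMod.natCast_eq_zero_iff _ _).1 h
    exact absurd (Nat.le_of_dvd (by omega) this) (by omega)
  have hmm : ((m : ℕ) : ZMod L) + (m : ℕ) = 0 := by rw [← Nat.cast_add, hmL, ZMod.natCast_self]
  set xm : Site d L := (0 : Site d L) + Pi.single 0 ((m : ℕ) : ZMod L) with hxm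
  have hxm0 : xm 0 = ((m : ℕ) : ZMod L) := by simp [hxm]
  have hxmj : xm j = 0 := by simp [hxm, Pi.single_eq_of_ne hj0]
  have hxmθ : xm.negReflect = xm := negReflect_of_two_mul (by rw [hxm0]; exact hmm)
  have hx00 : (0 : Site d L).negReflect = 0 := negReflect_of_two_mul (by simp)
  -- the observables
  set P : GaugeConfig d L G → ℂ := fun U => (ρ (lineHolonomy U j L 0)).trace with hP
  set P' : GaugeConfig d L G → ℂ := fun U => (ρ (lineHolonomy U j L xm)).trace with hP'
  set f : GaugeConfig d L G → ℂ := fun U => P U * conj (P' U) with hf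
  -- twist observables: `O w a` = exp(β(S - S_{w,(a,0)}))
  set O : G → ZMod L → GaugeConfig d L G → ℂ := fun w a U =>
    (Real.exp (β * (wilsonAction ρ U -
      insertedWilsonAction ρ (stackInsertion w ⟨((0 : Fin d), j), hj⟩ a 0) U)) : ℂ) with hO
  -- reflection invariance of `P`, `P'`, `f`
  have hPθ : ∀ U : GaugeConfig d L G, P U.negReflect = P U := fun U => by
    simp only [hP, WilsonLoopRP.lineHolonomy_negReflect_of_ne U hj0, hx00]
  have hP'θ : ∀ U : GaugeConfig d L G, P' U.negReflect = P' U := fun U => by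
    simp only [hP', WilsonLoopRP.lineHolonomy_negReflect_of_ne U hj0, hxmθ]
  have hfθ : ∀ U : GaugeConfig d L G, f U.negReflect = f U := fun U => by
    simp only [hf, hPθ, hP'θ]
  -- bounds and measurability of `f`
  have hPm : Measurable P := (WilsonLoopRP.entryMeasurable_lineHolonomy hρ j L 0).measurable_trace
  have hP'm : Measurable P' := (WilsonLoopRP.entryMeasurable_lineHolonomy hρ j L xm).measurable_trace
  have hfm : Measurable f := hPm.mul (Complex.continuous_conj.measurable.comp hP'm)
  have hfb : ∀ U, ‖f U‖ ≤ (N : ℝ) * N := fun U => by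
    rw [hf]; dsimp only; rw [norm_mul, Complex.norm_conj]
    exact mul_le_mul (norm_trace_le_dim ρ hρ _) (norm_trace_le_dim ρ hρ _) (norm_nonneg _) (Nat.cast_nonneg _)
  -- `f` is an admissible half-observable (both loops lie in the reflection planes)
  have hE : ∀ e : Edge d L, IsSitePosEdge e ∨ IsSharedEdge e →
      e ∈ ((sitePosEdges ∪ sharedEdges : Finset (Edge d L)) : Set (Edge d L)) := fun e he => by
    rw [Finset.coe_union, Set.mem_union, Finset.mem_coe, Finset.mem_coe, mem_sitePosEdges,
      mem_sharedEdges]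
    exact he
  have dep_line : ∀ (x : Site d L), (x 0 = 0 ∨ x 0 = ((m : ℕ) : ZMod L)) →
      DependsOn (fun U : GaugeConfig d L G => lineHolonomy U j L x)
      ((sitePosEdges ∪ sharedEdges : Finset (Edge d L)) : Set (Edge d L)) := by
    intro x hx U V hUV
    refine WilsonLoopRP.lineHolonomy_congr j L x fun s _ => hUV _ (hE _ (Or.inr ?_))
    refine ⟨hj0, ?_⟩
    dsimp only
    rw [show (x + Pi.single j ((s : ℕ) : ZMod L) : Site d L) 0 = x 0 by simp [Pi.single_eq_of_ne hj0.symm]]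
    rcases hx with hx | hx
    · left; rw [hx, ZMod.val_zero]
    · right; rw [hx, ZMod.val_natCast, Nat.mod_eq_of_lt hmlt]
  have hfdep : DependsOn f ((sitePosEdges ∪ sharedEdges : Finset (Edge d L)) : Set (Edge d L)) :=
    fun U V hUV => by
      simp only [hf, hP, hP', dep_line 0 (Or.inl rfl) hUV, dep_line xm (Or.inr hxm0) hUV]
  have hfobs : IsHalfObs f := ⟨hfm, ⟨_, hfb⟩, hfdep⟩
  have hcfobs : IsHalfObs (fun U => conj (f U)) :=
    ⟨Complex.continuous_conj.measurable.comp hfm, ⟨_, fun U => by rw [Complex.norm_conj]; exact hfb U⟩,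
      fun U V hUV => by simp only [hfdep hUV]⟩
  -- integrability helpers
  have hOobs : ∀ (w : G), IsHalfObs (fun U : GaugeConfig d L G => (1 : ℂ) - O w 0 U) := fun w =>
    isHalfObs_twistObs ρ ⟨rr, hrr⟩ hρ β w hj 0 1
  have hOm : ∀ (w : G) (a : ZMod L), Measurable (O w a) := fun w a =>
    Complex.measurable_ofReal.comp (Real.measurable_exp.comp
      (((WilsonRP.measurable_wilsonAction ρ hρ).sub (measurable_insertedWilsonAction ρ hρ _)).const_mul β))
  have hOb : ∀ (w : G) (a : ZMod L), ∃ C : ℝ, ∀ U, ‖O w a U‖ ≤ C := fun w a =>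
    ⟨_, fun U => by rw [hO]; exact norm_twistObs_le ρ hρ β _ U⟩
  have hint : ∀ (g : GaugeConfig d L G → ℂ), Measurable g → (∃ C : ℝ, ∀ U, ‖g U‖ ≤ C) →
      Integrable g (wilsonMeasure ρ β) := by
    rintro g hg ⟨C, hC⟩
    exact Integrable.of_bound hg.aestronglyMeasurable C (ae_of_all _ hC)
  have hfO_m : ∀ (w : G) (a : ZMod L), Measurable (fun U => f U * O w a U) := fun w a =>
    hfm.mul (hOm w a)
  have hfO_b : ∀ (w : G) (a : ZMod L), ∃ C : ℝ, ∀ U, ‖f U * O w a U‖ ≤ C := fun w a => by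
    obtain ⟨C, hC⟩ := hOb w a
    exact ⟨N * N * C, fun U => by
      rw [norm_mul]
      exact mul_le_mul (hfb U) (hC U) (norm_nonneg _)
        (mul_nonneg (Nat.cast_nonneg N) (Nat.cast_nonneg N))⟩
  -- expectations of twist observables
  have hOz : ∀ a : ZMod L, wilsonExpectation ρ β (O z a) = (r : ℂ) := fun a => by
    rw [hO]; exact wilsonExpectation_twistObs ρ hρ β hz _ a 0
  have hOzi : ∀ a : ZMod L, wilsonExpectation ρ β (O z⁻¹ a) = (r : ℂ) := fun a => by
    rw [hO]
    have h := wilsonExpectation_twistObs ρ hρ β (Subgroup.inv_mem _ hz) ⟨((0 : Fin d), j), hj⟩ a 0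
    rw [twistedPartitionFunction_inv ρ β hρ hz] at h
    exact h
  -- Step 1: moving the stack from `a = -1` to `a = 0` multiplies `P` by `ω⁻¹`
  set E : ℂ := wilsonExpectation ρ β f with hEdef
  have hmove : wilsonExpectation ρ β (fun U => f U * O z (-1) U) =
      ω⁻¹ * wilsonExpectation ρ β (fun U => f U * O z 0 U) := by
    have h1 := wilsonExpectation_mul_twistObs ρ hρ β (stackInsertion z ⟨((0 : Fin d), j), hj⟩ (-1) 0) f
    have h2 := wilsonExpectation_mul_twistObs ρ hρ β (stackInsertion z ⟨((0 : Fin d), j), hj⟩ 0 0) f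
    have h3 := integral_mul_exp_stack_succ ρ β hz ⟨((0 : Fin d), j), hj⟩ (-1) 0 f
    have hc : ∀ U : GaugeConfig d L G,
        f ((fun e : Edge d L => if e.2 = j ∧ e.1 0 = -1 + 1 ∧ e.1 j = 0 then z⁻¹ else 1) * U) =
          ω⁻¹ * f U := by
      intro U
      have hc0 : lineHolonomy ((fun e : Edge d L => if e.2 = j ∧ e.1 0 = -1 + 1 ∧ e.1 j = 0 then z⁻¹
          else 1) * U) j L 0 = z⁻¹ * lineHolonomy U j L 0 :=
        lineHolonomy_stackMove_of_eq (-1) 0 U 0 (by simp) (by simp)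
      have hcm : lineHolonomy ((fun e : Edge d L => if e.2 = j ∧ e.1 0 = -1 + 1 ∧ e.1 j = 0 then z⁻¹
          else 1) * U) j L xm = lineHolonomy U j L xm :=
        lineHolonomy_stackMove_of_ne hj0 z (-1) 0 U L xm (by rw [hxm0, neg_add_cancel]; exact hm0)
      simp only [hf, hP, hP', hc0, hcm, trace_central_mul ρ hωinv]
      ring
    simp only [hO]
    rw [h1, h2, h3]
    dsimp only
    simp_rw [hc]
    simp only [neg_add_cancel, mul_assoc]
    rw [integral_const_mul, Complex.real_smul, Complex.real_smul]
    ring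
  -- Step 2: the algebraic identity `(1 - ω) E = T₀ - ω T₋₁`
  have hsplit : ∀ a : ZMod L, E = wilsonExpectation ρ β (fun U => f U * ((1 : ℂ) - O z a U)) +
      wilsonExpectation ρ β (fun U => f U * O z a U) := fun a => by
    have i1 : Integrable (fun U => f U * ((1 : ℂ) - O z a U)) (wilsonMeasure ρ β) := by
      obtain ⟨C, hC⟩ := hfO_b z a
      refine hint _ (hfm.mul (measurable_const.sub (hOm z a))) ⟨N * N + C, fun U => ?_⟩
      rw [mul_sub, mul_one]
      exact (norm_sub_le _ _).trans (add_le_add (hfb U) (hC U))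
    rw [hEdef]
    unfold wilsonExpectation
    rw [← integral_add i1 (hint _ (hfO_m z a) (hfO_b z a))]
    refine integral_congr_ae (ae_of_all _ fun U => ?_)
    show f U = f U * (1 - O z a U) + f U * O z a U
    ring
  set T0 : ℂ := wilsonExpectation ρ β (fun U => f U * ((1 : ℂ) - O z 0 U)) with hT0
  set T1 : ℂ := wilsonExpectation ρ β (fun U => f U * ((1 : ℂ) - O z (-1) U)) with hT1
  have hkey : (1 - ω) * E = T0 - ω * T1 := by
    have e0 := hsplit 0
    have e1 := hsplit (-1)
    rw [← hT0] at e0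
    rw [← hT1, hmove] at e1
    have : ω * (E - T1) = wilsonExpectation ρ β (fun U => f U * O z 0 U) := by
      rw [e1, add_sub_cancel_left, ← mul_assoc, mul_inv_cancel₀ hω0, one_mul]
    linear_combination e0 - this
  -- Step 3: Cauchy–Schwarz for `T₀ = B(conj f, 1 - O_z,0)`
  have hB_f : ∀ (g : GaugeConfig d L G → ℂ), IsHalfObs g →
      (siteRPForm ρ β (fun _ : Unit => fun U => conj (f U)) (fun _ : Unit => g)) =
        wilsonExpectation ρ β (fun U => f U * g U) := fun g hg => by
    unfold siteRPForm wilsonExpectation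
    rw [Fintype.sum_unique]
    refine integral_congr_ae (ae_of_all _ fun U => ?_)
    simp only [Complex.conj_conj, hfθ]
  have hB_ff : (siteRPForm ρ β (fun _ : Unit => fun U => conj (f U)) (fun _ : Unit => fun U => conj (f U))).re
      ≤ (N : ℝ) ^ 4 := by
    unfold siteRPForm
    rw [Fintype.sum_unique]
    have hb : ∀ U : GaugeConfig d L G, ‖conj (conj (f U.negReflect)) * conj (f U)‖ ≤ (N : ℝ) ^ 4 := fun U => by
      rw [norm_mul, Complex.norm_conj, Complex.norm_conj, Complex.norm_conj, hfθ,
        show (N : ℝ) ^ 4 = (N * N) * (N * N) by ring]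
      exact mul_le_mul (hfb U) (hfb U) (norm_nonneg _) (by positivity)
    refine (Complex.re_le_norm _).trans ((norm_integral_le_of_norm_le_const (ae_of_all _ hb)).trans ?_)
    rw [probReal_univ, mul_one]
  -- the Gram entry of the twist observable: `⟨(1 - O')(1 - O)⟩ = 2(1 - r)`
  have hGram : ∀ (w : G), w ∈ Subgroup.center G →
      (wilsonExpectation ρ β (O w 0) = (r : ℂ)) → (wilsonExpectation ρ β (O w⁻¹ (-1)) = (r : ℂ)) →
      siteRPForm ρ β (fun _ : Unit => fun U => (1 : ℂ) - O w 0 U) (fun _ : Unit => fun U => (1 : ℂ) - O w 0 U)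
        = ((2 * (1 - r) : ℝ) : ℂ) := by
    intro w hw hw0 hw1
    have hrefl : ∀ U : GaugeConfig d L G, O w 0 U.negReflect = O w⁻¹ (-1) U := fun U => by
      simp only [hO, twistObs_negReflect ρ ⟨rr, hrr⟩ hρ β hw hj, zero_add]
    have hprod : wilsonExpectation ρ β (fun U => O w⁻¹ (-1) U * O w 0 U) = 1 := by
      have h := wilsonExpectation_twistObs_inv_mul_twistObs ρ hρ β hw ⟨((0 : Fin d), j), hj⟩ (-1 : ZMod L) 0
      simp only [neg_add_cancel] at h
      rw [hO]; exact h
    unfold siteRPForm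
    rw [Fintype.sum_unique]
    have hreal : ∀ U : GaugeConfig d L G, conj ((1 : ℂ) - O w 0 U.negReflect) = 1 - O w⁻¹ (-1) U := fun U => by
      rw [map_sub, map_one, hrefl, hO]; dsimp only; rw [Complex.conj_ofReal]
    simp_rw [hreal]
    have hpt : ∀ U : GaugeConfig d L G, ((1 : ℂ) - O w⁻¹ (-1) U) * (1 - O w 0 U) =
        1 - O w⁻¹ (-1) U - O w 0 U + O w⁻¹ (-1) U * O w 0 U := fun U => by ring
    simp_rw [hpt]
    have i1 : Integrable (fun _ : GaugeConfig d L G => (1 : ℂ)) (wilsonMeasure ρ β) := integrable_const _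
    have i2 := hint _ (hOm w⁻¹ (-1)) (hOb w⁻¹ (-1))
    have i3 := hint _ (hOm w 0) (hOb w 0)
    have i12 : Integrable (fun U : GaugeConfig d L G => (1 : ℂ) - O w⁻¹ (-1) U) (wilsonMeasure ρ β) :=
      i1.sub i2
    have i123 : Integrable (fun U : GaugeConfig d L G => (1 : ℂ) - O w⁻¹ (-1) U - O w 0 U)
        (wilsonMeasure ρ β) := i12.sub i3
    have i4 : Integrable (fun U => O w⁻¹ (-1) U * O w 0 U) (wilsonMeasure ρ β) := by
      obtain ⟨C2, hC2⟩ := hOb w⁻¹ (-1)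
      obtain ⟨C3, hC3⟩ := hOb w 0
      exact hint _ ((hOm _ _).mul (hOm _ _)) ⟨C2 * C3, fun U => by
        rw [norm_mul]; exact mul_le_mul (hC2 U) (hC3 U) (norm_nonneg _) ((norm_nonneg _).trans (hC2 U))⟩
    rw [integral_add i123 i4, integral_sub i12 i3, integral_sub i1 i2,
      integral_const, probReal_univ, one_smul]
    change 1 - wilsonExpectation ρ β (O w⁻¹ (-1)) - wilsonExpectation ρ β (O w 0) +
      wilsonExpectation ρ β (fun U => O w⁻¹ (-1) U * O w 0 U) = _
    rw [hw1, hw0, hprod]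
    push_cast
    ring
  have hGz := hGram z hz (hOz 0) (hOzi (-1))
  have hGzi := hGram z⁻¹ (Subgroup.inv_mem _ hz) (hOzi 0) (by rw [inv_inv]; exact hOz (-1))
  -- `|T₀|² ≤ N⁴ · 2(1-r)`
  have hT0b : ‖T0‖ ^ 2 ≤ (N : ℝ) ^ 4 * (2 * (1 - r)) := by
    have hCS := normSq_siteRPForm_le ρ ⟨rr, hrr⟩ hρ β (fun _ : Unit => hcfobs) (fun _ : Unit => hOobs z)
    rw [hB_f _ (hOobs z), hGz, Complex.ofReal_re] at hCS
    rw [hT0]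
    exact hCS.trans (mul_le_mul_of_nonneg_right hB_ff (by linarith))
  -- `|T₋₁|² ≤ 2(1-r) · N⁴`: here the twist observable is reflected to the positive side
  have hT1b : ‖T1‖ ^ 2 ≤ (2 * (1 - r)) * (N : ℝ) ^ 4 := by
    have hF' : IsHalfObs (fun U : GaugeConfig d L G => (1 : ℂ) - O z⁻¹ 0 U) := hOobs z⁻¹
    have hCS := normSq_siteRPForm_le ρ ⟨rr, hrr⟩ hρ β (fun _ : Unit => hF') (fun _ : Unit => hfobs)
    have h12 : siteRPForm ρ β (fun _ : Unit => fun U => (1 : ℂ) - O z⁻¹ 0 U) (fun _ : Unit => f) = T1 := by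
      unfold siteRPForm
      rw [Fintype.sum_unique, hT1]
      unfold wilsonExpectation
      refine integral_congr_ae (ae_of_all _ fun U => ?_)
      have hrefl : O z⁻¹ 0 U.negReflect = O z (-1) U := by
        simp only [hO, twistObs_negReflect ρ ⟨rr, hrr⟩ hρ β (Subgroup.inv_mem _ hz) hj, zero_add, inv_inv]
      show conj ((1 : ℂ) - O z⁻¹ 0 U.negReflect) * f U = f U * (1 - O z (-1) U)
      rw [map_sub, map_one, hrefl, hO]; dsimp only; rw [Complex.conj_ofReal]; ring
    have h22 : (siteRPForm ρ β (fun _ : Unit => f) (fun _ : Unit => f)).re ≤ (N : ℝ) ^ 4 := by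
      unfold siteRPForm
      rw [Fintype.sum_unique]
      have hb : ∀ U : GaugeConfig d L G, ‖conj (f U.negReflect) * f U‖ ≤ (N : ℝ) ^ 4 := fun U => by
        rw [norm_mul, Complex.norm_conj, hfθ, show (N : ℝ) ^ 4 = (N * N) * (N * N) by ring]
        exact mul_le_mul (hfb U) (hfb U) (norm_nonneg _) (by positivity)
      refine (Complex.re_le_norm _).trans ((norm_integral_le_of_norm_le_const (ae_of_all _ hb)).trans ?_)
      rw [probReal_univ, mul_one]
    rw [h12, hGzi, Complex.ofReal_re] at hCS
    exact hCS.trans (mul_le_mul_of_nonneg_left h22 (by linarith))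
  -- Step 4: assemble
  have hA0 : 0 ≤ (N : ℝ) ^ 4 * (2 * (1 - r)) := mul_nonneg (by positivity) (by linarith)
  have hT0n : ‖T0‖ ≤ Real.sqrt ((N : ℝ) ^ 4 * (2 * (1 - r))) := by
    simpa only [abs_norm] using Real.abs_le_sqrt hT0b
  have hT1n : ‖T1‖ ≤ Real.sqrt ((N : ℝ) ^ 4 * (2 * (1 - r))) := by
    rw [mul_comm] at hT1b
    simpa only [abs_norm] using Real.abs_le_sqrt hT1b
  have hEq : ‖1 - ω‖ * ‖E‖ ≤ 2 * Real.sqrt ((N : ℝ) ^ 4 * (2 * (1 - r))) := by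
    calc ‖1 - ω‖ * ‖E‖ = ‖T0 - ω * T1‖ := by rw [← norm_mul, hkey]
      _ ≤ ‖T0‖ + ‖ω * T1‖ := norm_sub_le _ _
      _ = ‖T0‖ + ‖T1‖ := by rw [norm_mul, hω1, one_mul]
      _ ≤ _ := by linarith
  have hsq := pow_le_pow_left₀ (mul_nonneg (norm_nonneg _) (norm_nonneg _)) hEq 2
  rw [mul_pow, mul_pow, Real.sq_sqrt hA0] at hsq
  change ‖1 - ω‖ ^ 2 * ‖E‖ ^ 2 ≤ 8 * (N : ℝ) ^ 4 * (1 - r)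
  calc ‖1 - ω‖ ^ 2 * ‖E‖ ^ 2 ≤ 2 ^ 2 * ((N : ℝ) ^ 4 * (2 * (1 - r))) := hsq
    _ = 8 * (N : ℝ) ^ 4 * (1 - r) := by ring

/-- **(A1.8) for a centre element acting as `-1`** (`SU(2)` with `z = -1`, or `-1 ∈ SU(2n)`, in a
representation with `ρ(z) = -1`): `|E|² ≤ 2 N⁴ (1 - Z(z)/Z(1))`, i.e. with normalised traces
`G_{L/2}² ≤ 4 · ½(1 - Z⁻/Z)`, the square of the printed `G_{L_s/2} ≤ 2 exp(-F^{elec}/2T)` with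
`exp(-F^{elec}/T) = ½(1 - Z⁻/Z)` (eqs. (2.8), (2.9)). [cite: TomboulisYaffe1985, App. I §C eq. (A1.8)] -/
theorem polyakovCorrelator_half_normSq_le_twist_of_neg (hL : Even L) (hρ : Continuous ρ) (β : ℝ)
    {j : Fin d} (hj : (0 : Fin d) < j) {z : G} (hz : z ∈ Subgroup.center G)
    (hω : ρ z = -(1 : Matrix (Fin N) (Fin N) ℂ)) :
    ‖wilsonExpectation ρ β fun U : GaugeConfig d L G =>
        (ρ (lineHolonomy U j L 0)).trace *
          conj ((ρ (lineHolonomy U j L ((0 : Site d L) + Pi.single 0 ((L / 2 : ℕ) : ZMod L)))).trace)‖ ^ 2 ≤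
      2 * (N : ℝ) ^ 4 * (1 - twistedPartitionFunction ρ β L z ⟨(0, j), hj⟩ /
        twistedPartitionFunction ρ β L 1 ⟨(0, j), hj⟩) := by
  have h := polyakovCorrelator_half_normSq_le_twist ρ hL hρ β hj hz (ω := -1)
    (by rw [hω, neg_smul, one_smul]) (by simp)
  have h4 : ‖(1 : ℂ) - -1‖ = 2 := by rw [sub_neg_eq_add, one_add_one_eq_two, Complex.norm_two]
  rw [h4] at h
  linarith

end HalfCorrelator

end TomboulisYaffe

end

end Literature.MathematicalPhysics.QuantumFieldTheory
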